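import Mathlib
import HarnessLib
import Literature.MathematicalPhysics.QuantumLattice.HubbardTorus2DTiling
import Literature.MathematicalPhysics.QuantumLattice.HubbardOneParticleCost
import Literature.MathematicalPhysics.QuantumLattice.HubbardModelParticleHoleProofs
import Summits.HubbardSuperconductivity.HubbardSuperconductivity.Theorems.WeakCouplingBCSWcbcsBcsConstructionTorusBoxComparison
import Summits.HubbardSuperconductivity.HubbardSuperconductivity.Theorems.ThermalWedgeTwPureThermalBoundSectorLipschitz

/-!
# Route `ThermalWedge`, item `stmt-HubbardSuperconductivity-1702` (`TwPureThermalBound`):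
# the Hubbard torus satisfies the hypotheses of the abstract density-limit layer

Support file (`--supports stmt-HubbardSuperconductivity-1702`; no definition). For the sector energies
`E L K := groundEnergyAt (fermionRectTorusGraph L L) 1 U K` (`= groundEnergyAt (fermionTorusGraph 2 L) 1 U K`,
`groundEnergyAt_fermionTorusGraph_two`) of the repulsive (`U ≥ 0`) Hubbard model on the `L × L` torus we
discharge the hypotheses of `ThermalWedgeTwPureThermalBoundDensityLimit{B,…,E}`:
* (low) `−8L² ≤ E L K` (`groundEnergyAt_rect_mem_Icc`);
* (up) `E L (K+1) ≤ E L K + 72(2+U)` for `2(K+1) ≤ 3L²` (the one-particle addition cost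
  `ThermodynamicLimit.groundEnergyAt_succ_le` at density `< 3/2`);
* (down) `E L (K−1) ≤ E L K + 72(2+U)` (in fact `+4`: `ptb_groundEnergyAt_pred_le`, density-uniform);
* (tile) `T = 16` and (fill) `F = 8 + U` (`groundEnergyAt_square_tiling`, `groundEnergyAt_square_fill`);
* (reflU) `|E L (2L²−K) − E L K − U(L²−K)| ≤ 16(L+1)`: the torus and the free-boundary box energies differ
  by `≤ 8L` in every sector (`groundEnergyAt_le_add_of_adj_mismatch`, `card_filter_le_of_not_adj_iff`), and
  on the (bipartite) box the particle–hole relation `E(N) = E(2|Λ|−N) − (|Λ|−N)U` is exact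
  (`groundEnergyAt_particleHole` with the chessboard sign `(−1)^{x₀+x₁}`, written with `Even`).
Folklore (Ruelle 1969 §2–3; Lieb–Wu 2003 §1 eq. (3)).
-/

set_option linter.dupNamespace false

noncomputable section

namespace Summit.HubbardSuperconductivity.HubbardSuperconductivity.Theorems

open Literature.MathematicalPhysics.QuantumLattice Literature.Probability.LatticeModels Matrix Finset
open scoped ComplexOrder BigOperators

/-! ### (low), (up), (down), (tile), (fill) on the square torus -/

/-- (low): `−8L² ≤ E L K` for `K ≤ 2L²`, `U ≥ 0`. [folklore] -/
theorem ptb_torus_low {U : ℝ} (hU : 0 ≤ U) (L K : ℕ) (hK : K ≤ 2 * L ^ 2) :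
    -(8 * (L : ℝ) ^ 2) ≤ groundEnergyAt (fermionRectTorusGraph L L) 1 U K := by
  have hK' : K ≤ 2 * (L * L) := by simpa [sq] using hK
  have h := (ThermodynamicLimit.groundEnergyAt_rect_mem_Icc L L 1 hU hK').1
  rw [abs_one] at h
  have e : ((L : ℝ)) ^ 2 = (L : ℝ) * L := by ring
  rw [e]
  linarith

/-- (up): `E L (K+1) ≤ E L K + 72(2+U)` for `2(K+1) ≤ 3L²`, `U ≥ 0` (one-particle addition below density
`3/2`). [folklore] -/
theorem ptb_torus_up {U : ℝ} (hU : 0 ≤ U) (L K : ℕ) (hK : 2 * (K + 1) ≤ 3 * L ^ 2) :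
    groundEnergyAt (fermionRectTorusGraph L L) 1 U (K + 1) ≤
      groundEnergyAt (fermionRectTorusGraph L L) 1 U K + 72 * (2 + U) := by
  have hcard : Fintype.card (Fin L ×ₗ Fin L) = L * L := card_rectSites L L
  have hK' : 2 * (K + 1) ≤ 3 * (L * L) := by simpa [sq] using hK
  have hKlt : K < 2 * Fintype.card (Fin L ×ₗ Fin L) := by
    rw [hcard]
    generalize hM : L * L = M at hK' ⊢
    omega
  have h := ThermodynamicLimit.groundEnergyAt_succ_le (fermionRectTorusGraph L L) (Δ := 4)
    (ThermodynamicLimit.card_filter_fermionRectTorusGraph_adj_le L L) 1 U hKlt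
  rw [hcard] at h
  have hLL : 2 * ((K : ℝ) + 1) ≤ 3 * ((L : ℝ) * L) := by exact_mod_cast hK'
  have hApos : 0 < 2 * ((L : ℝ) * L) - K := by linarith
  have hfrac : ((2 * 4 + 1 : ℕ) : ℝ) * (2 * (2 * |(1 : ℝ)| + |U|)) * (2 * ((L * L : ℕ) : ℝ)) /
      (2 * ((L * L : ℕ) : ℝ) - K) ≤ 72 * (2 + U) := by
    rw [abs_one, abs_of_nonneg hU]
    push_cast
    rw [div_le_iff₀ hApos]
    have h72 : 0 ≤ 72 * (2 + U) := by positivity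
    nlinarith [hLL, h72]
  linarith [h, hfrac]

/-- (down): `E L (K−1) ≤ E L K + 72(2+U)` for `1 ≤ K ≤ 2L²`, `U ≥ 0` (in fact `+4`, uniformly in the
density: `ptb_groundEnergyAt_pred_le`). [folklore] -/
theorem ptb_torus_down {U : ℝ} (hU : 0 ≤ U) (L K : ℕ) (hK1 : 1 ≤ K) (hK : K ≤ 2 * L ^ 2) :
    groundEnergyAt (fermionRectTorusGraph L L) 1 U (K - 1) ≤
      groundEnergyAt (fermionRectTorusGraph L L) 1 U K + 72 * (2 + U) := by
  have hcard : Fintype.card (Fin L ×ₗ Fin L) = L * L := card_rectSites L L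
  have hK' : K ≤ 2 * Fintype.card (Fin L ×ₗ Fin L) := by rw [hcard]; simpa [sq] using hK
  have h := ptb_groundEnergyAt_pred_le (fermionRectTorusGraph L L) (Δ := 4)
    (ThermodynamicLimit.card_filter_fermionRectTorusGraph_adj_le L L) 1 hU hK1 hK'
  rw [abs_one] at h
  push_cast at h
  nlinarith [h, hU]

/-- (tile): `E_{(k+1)M}(Σ N_{ij}) ≤ Σ E_M(N_{ij}) + 16 M k (k+1)`. [folklore] -/
theorem ptb_torus_tile (U : ℝ) (M k : ℕ) (Ns : Fin (k + 1) → Fin (k + 1) → ℕ)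
    (hNs : ∀ i j, Ns i j ≤ 2 * (M * M)) :
    groundEnergyAt (fermionRectTorusGraph ((k + 1) * M) ((k + 1) * M)) 1 U (∑ i, ∑ j, Ns i j) ≤
      ∑ i, ∑ j, groundEnergyAt (fermionRectTorusGraph M M) 1 U (Ns i j) + 16 * M * k * (k + 1) := by
  have h := ThermodynamicLimit.groundEnergyAt_square_tiling M 1 U k Ns hNs
  rw [abs_one, mul_one] at h
  exact h

/-- (fill): `E_{ℓ+r}(N + N_B) ≤ E_ℓ(N) + (8+U)((rℓ + r(ℓ+r)) + (2ℓ + r))`. [folklore] -/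
theorem ptb_torus_fill {U : ℝ} (hU : 0 ≤ U) (ℓ r N NB : ℕ) (hN : N ≤ 2 * (ℓ * ℓ))
    (hNB : NB ≤ 2 * (r * ℓ + r * (ℓ + r))) :
    groundEnergyAt (fermionRectTorusGraph (ℓ + r) (ℓ + r)) 1 U (N + NB) ≤
      groundEnergyAt (fermionRectTorusGraph ℓ ℓ) 1 U N +
        (8 + U) * ((r * ℓ + r * (ℓ + r) : ℕ) + (2 * ℓ + r : ℕ)) := by
  have h := ThermodynamicLimit.groundEnergyAt_square_fill ℓ r 1 hU hN hNB
  rw [abs_one] at h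
  push_cast at h ⊢
  have h0 : 0 ≤ U * (2 * (ℓ : ℝ) + r) := by positivity
  have e : (8 + U) * ((r : ℝ) * ℓ + r * (ℓ + r) + (2 * ℓ + r)) =
      (8 * 1 + U) * ((r : ℝ) * ℓ + r * (ℓ + r)) + 8 * 1 * (2 * ℓ + r) + U * (2 * (ℓ : ℝ) + r) := by ring
  rw [e]
  linarith

/-! ### Torus versus box, and the particle–hole reflection -/

/-- **The chessboard sign is a bipartite sign of the free-boundary box.** [folklore] -/
theorem ptb_boxSign_adj {L : ℕ} {x y : FermionTorus 2 L}
    (h : ((zdGraph 2).comap (fun x : FermionTorus 2 L => fun i : Fin 2 => ((ofLex x i : ℕ) : ℤ))).Adj x y) :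
    (if Even ((ofLex x 0 : ℕ) + (ofLex x 1 : ℕ)) then (1 : ℤˣ) else -1) =
      -(if Even ((ofLex y 0 : ℕ) + (ofLex y 1 : ℕ)) then (1 : ℤˣ) else -1) := by
  rw [boxGraph_two_adj_iff] at h
  have hs : (ofLex y 0 : ℕ) + (ofLex y 1 : ℕ) = ((ofLex x 0 : ℕ) + (ofLex x 1 : ℕ)) + 1 ∨
      (ofLex x 0 : ℕ) + (ofLex x 1 : ℕ) = ((ofLex y 0 : ℕ) + (ofLex y 1 : ℕ)) + 1 := by
    rcases h with ⟨h1, h2⟩ | ⟨h1, h2⟩ | ⟨h1, h2⟩ | ⟨h1, h2⟩ <;> omega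
  rcases hs with hs | hs
  · rw [hs]
    generalize ((ofLex x 0 : ℕ) + (ofLex x 1 : ℕ)) = s
    by_cases he : Even s
    · simp [he, Nat.even_add_one]
    · simp [he, Nat.even_add_one]
  · rw [hs]
    generalize ((ofLex y 0 : ℕ) + (ofLex y 1 : ℕ)) = s
    by_cases he : Even s
    · simp [he, Nat.even_add_one]
    · simp [he, Nat.even_add_one]

/-- **Torus versus box, sector by sector**: `|E_T(N) − E_B(N)| ≤ 8L` (the adjacencies differ on `≤ 4L`
ordered wrap-around pairs, each costing `≤ 2`). [folklore] -/
theorem ptb_torus_box_abs_sub_le (U : ℝ) (L N : ℕ) (hN : N ≤ 2 * Fintype.card (FermionTorus 2 L)) :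
    |groundEnergyAt (fermionTorusGraph 2 L) 1 U N -
      groundEnergyAt ((zdGraph 2).comap (fun x : FermionTorus 2 L => fun i : Fin 2 => ((ofLex x i : ℕ) : ℤ)))
        1 U N| ≤ 8 * L := by
  have h1 := groundEnergyAt_le_add_of_adj_mismatch (fermionTorusGraph 2 L)
    ((zdGraph 2).comap (fun x : FermionTorus 2 L => fun i : Fin 2 => ((ofLex x i : ℕ) : ℤ)))
    (card_filter_le_of_not_adj_iff _ fun p hp => hp) 1 U hN
  have h2 := groundEnergyAt_le_add_of_adj_mismatch
    ((zdGraph 2).comap (fun x : FermionTorus 2 L => fun i : Fin 2 => ((ofLex x i : ℕ) : ℤ)))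
    (fermionTorusGraph 2 L) (card_filter_le_of_not_adj_iff _ fun p hp h => hp h.symm) 1 U hN
  rw [abs_one, Nat.cast_mul, Nat.cast_ofNat] at h1 h2
  rw [abs_le]
  constructor <;> linarith

/-- (reflU): **approximate particle–hole symmetry of the torus sector energies**,
`|E L (2L²−K) − E L K − U(L² − K)| ≤ 16(L+1)` for `K ≤ 2L²` (all `L`, even or odd). [folklore] -/
theorem ptb_torus_reflU (U : ℝ) (L K : ℕ) (hK : K ≤ 2 * L ^ 2) :
    |groundEnergyAt (fermionRectTorusGraph L L) 1 U (2 * L ^ 2 - K) -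
        groundEnergyAt (fermionRectTorusGraph L L) 1 U K - U * ((L : ℝ) ^ 2 - K)| ≤ 16 * ((L : ℝ) + 1) := by
  rw [← groundEnergyAt_fermionTorusGraph_two, ← groundEnergyAt_fermionTorusGraph_two]
  have hcard : Fintype.card (FermionTorus 2 L) = L ^ 2 := by simp [FermionTorus, Fintype.card_lex]
  have hK' : K ≤ 2 * Fintype.card (FermionTorus 2 L) := by rw [hcard]; exact hK
  have hK2' : 2 * L ^ 2 - K ≤ 2 * Fintype.card (FermionTorus 2 L) := by rw [hcard]; omega
  have h1 := ptb_torus_box_abs_sub_le U L K hK'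
  have h2 := ptb_torus_box_abs_sub_le U L (2 * L ^ 2 - K) hK2'
  have hph := groundEnergyAt_particleHole
    ((zdGraph 2).comap (fun x : FermionTorus 2 L => fun i : Fin 2 => ((ofLex x i : ℕ) : ℤ)))
    (fun x => if Even ((ofLex x 0 : ℕ) + (ofLex x 1 : ℕ)) then (1 : ℤˣ) else -1)
    (fun x y hxy => ptb_boxSign_adj hxy) 1 U hK'
  rw [hcard] at hph
  push_cast at hph
  have hL0 : (0 : ℝ) ≤ L := Nat.cast_nonneg L
  rw [abs_le] at h1 h2 ⊢
  constructor <;> linarith [h1.1, h1.2, h2.1, h2.2, hph]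

end Summit.HubbardSuperconductivity.HubbardSuperconductivity.Theorems

end
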